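import Summits.QuantumFields.BalabanUV.Beta.FP.PerfectKernelSymm
import Summits.QuantumFields.BalabanUV.Beta.FP.PerfectJetsTranslate

/-!
# `BalabanUV.Beta.FP.PerfectKernelSymmOne` — road «FP» for binder row D1: THE SOCKET `hTsymm` OF `StepLawWardRows` AT THE ROAD's LITERAL, from ONE structural
# datum — the bond-swap SYMMETRY of the wall's second-order tables `W j μ y ν y′ = W j ν y′ μ y` — plus the pins, the tables' (Wt) row and class data

HONEST DEPENDENCY (page 1, mandatory): continuum YM on T⁴ ⇐ BetaPertH ∧ nine spine estimates (0/9 proved); BetaPertH ⇐ (D1) ∧ (D4) ∧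
CAP+tail; G-an2-4 gates asym, D1 and NE2/3/4.  HONEST FRAMING (cell contract, verbatim): «discharging `BetaPertH` makes Bałaban's UV
stability UNCONDITIONAL — a real constructive-QFT result; it is NOT the continuum limit and NOT the Clay problem.»  THIS MODULE DISCHARGES
NOTHING of D1 / BetaPertH: [folklore]∕[our object] composition BY NAME of gen 4's `PerfectKernelSymm.TPerfOf_swap` with leaf-06's `PerfectJetsTranslate`
(coarse covariance of the perfect one-step stencils∕tables from the pins + the (Wt) row), `SymmetryKSlot.shiftK_KPerf_one`, `StepLawKHolds.exists_decays_KPerf_holds`.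
The table symmetry, the pins, the (Wt) row and the class datum are DISPLAYED hypotheses.  No `def`, no cited fact, 0 sorry; NOT D1, NOT BetaPertH, NOT
continuum, NOT Clay.

ABSOLUTE RULE (cell charter, verbatim): «No internally-minted statement may enter as a cited fact. Every hypothesis is either
kernel-proved in this package or a verbatim quotation of a PUBLISHED theorem with page reference. The manuscript(s) under audit are NOT
citable for their own disputed steps — they are the thing under adjudication; programme-internal (2001/route/tribunal) claims are never
citable.»

CONTENT: `symm_limTabOf` (bond-swap symmetry passes to the constructed table limit — unconditionally, `limTabOf_apply`), `WPerfOf_one_symm`,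
**`TPerfOf_one_swap`** = the `hTsymm` binder of `StepLawWardRows.d1Drift_JsBalOf_of_rows_ward_bounded` (`TPerfOf Lc (KPerf …1) (SPerfOf … S 1) (WPerfOf … Wt 1)
a b t = (same) b a (−t)`) ⟸ {`2 ≤ Lc`, pins `hS1`∕`hW1`, the tables' (Wt) row `hWt`, their SYMMETRY `hWsymm`, a `LocStencil` class datum of `SPerfOf … S 1`}.
NET for road FP after gen 4: the symmetry-type inputs of `D1Drift` via road FP are an1's Ward row `hWj` and the TABLE SYMMETRY `hWsymm` — no reflection row.
Unit `b2b-balaban-beta-d1-formalise-leaf-02` (gen 4).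
-/

noncomputable section

namespace Summit.QuantumFields.BalabanUV.Beta.FP.PerfectKernelSymmOne

open Filter Topology
open Literature.MathematicalPhysics.QuantumFieldTheory.Balaban1983to89
open Literature.MathematicalPhysics.QuantumFieldTheory.Balaban1983to89.Beta
open ExpKernelCalculus (MKer Decays VertexFamily₂ shiftK)
open OneStepResolventKernel (Fib LocStencil)
open BalabanStepJetsSucc (JsBal0Of)
open HessKerDressedLimit (limTabOf limMKerOf limTabOf_apply)
open Summit.QuantumFields.BalabanUV.Beta.HessKerDressedUnits (unitW)
open Summit.QuantumFields.BalabanUV.Beta.GAN24.CombesThomas (sfStep smStep)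
open Summit.QuantumFields.BalabanUV.Beta.FP.PerfectObjectsT (KPerf SPerfOf WPerfOf WPerfOf_one TPerfOf)
open Summit.QuantumFields.BalabanUV.Beta.FP.SymmetryKSlot (shiftK_KPerf_one)
open Summit.QuantumFields.BalabanUV.Beta.FP.PerfectJetsTranslate (SPerfOf_one_translate WPerfOf_one_translate)
open Summit.QuantumFields.BalabanUV.Beta.FP.StepLawKHolds (exists_decays_KPerf_holds)
open Summit.QuantumFields.BalabanUV.Beta.FP.PerfectKernelSymm (TPerfOf_swap)

/-- [folklore] **Bond-swap symmetry passes to the constructed table limit — unconditionally** (`limTabOf W μ y ν y′ = limMKerOf (j ↦ W j μ y ν y′)`). -/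
theorem symm_limTabOf {D : ℕ} {F ι κ : Type*} {W : ℕ → ι → κ → ι → κ → MKer D F}
    (h : ∀ (j : ℕ) (μ : ι) (y : κ) (ν : ι) (y' : κ), W j μ y ν y' = W j ν y' μ y) (μ : ι) (y : κ) (ν : ι) (y' : κ) :
    limTabOf W μ y ν y' = limTabOf W ν y' μ y := by
  rw [limTabOf_apply, limTabOf_apply]
  exact congrArg limMKerOf (funext fun j => h j μ y ν y')

section Perfect

variable {Lc : ℕ} [NeZero Lc] (hLc : 1 ≤ Lc) (cE cVH cΛ : ℝ)
  (W : ℕ → Fin (3 + 1) → (Fin (3 + 1) → ℤ) → Fin (3 + 1) → (Fin (3 + 1) → ℤ) → MKer (3 + 1) (Fib 3))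
  (Cw' δw : ℕ → ℝ) (hδw : ∀ j, 0 < δw j) (hW' : ∀ j, VertexFamily₂ (W j) Lc (Cw' j) (δw j))
  (S : ℕ → ℕ → Fin (3 + 1) → (Fin (3 + 1) → ℤ) → MKer (3 + 1) (Fib 3))
  (Wt : ℕ → ℕ → Fin (3 + 1) → (Fin (3 + 1) → ℤ) → Fin (3 + 1) → (Fin (3 + 1) → ℤ) → MKer (3 + 1) (Fib 3))

omit [NeZero Lc] in
/-- [folklore] **THE PERFECT ONE-STEP TABLE IS BOND-SWAP SYMMETRIC** if every wall table is (pin `hW1`; `unitW` acts entrywise, `symm_limTabOf`). -/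
theorem WPerfOf_one_symm (sf sm : ℕ → ℝ)
    (hWsymm : ∀ (j : ℕ) (μ : Fin (3 + 1)) (y : Fin (3 + 1) → ℤ) (ν : Fin (3 + 1)) (y' : Fin (3 + 1) → ℤ), W j μ y ν y' = W j ν y' μ y)
    (hW1 : ∀ j, Wt j 1 = W j) (μ : Fin (3 + 1)) (y : Fin (3 + 1) → ℤ) (ν : Fin (3 + 1)) (y' : Fin (3 + 1) → ℤ) :
    WPerfOf sf sm Wt 1 μ y ν y' = WPerfOf sf sm Wt 1 ν y' μ y := by
  rw [WPerfOf_one sf sm hW1]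
  exact symm_limTabOf (W := fun j => unitW (sf j) (sm j) (W j)) (fun j μ₀ y₀ ν₀ y₀' => by
    show HessKerDressedUnits.counitK (sf j) (sm j) (W j μ₀ y₀ ν₀ y₀') = HessKerDressedUnits.counitK (sf j) (sm j) (W j ν₀ y₀' μ₀ y₀)
    rw [hWsymm j]) μ y ν y'

/-- [our object] **THE SOCKET `hTsymm` OF `StepLawWardRows` AT THE ROAD's LITERAL** (`d = 3`, `2 ≤ Lc`, adopted units): the transposition symmetry
`TPerfOf Lc (KPerf Lc (sfStep Lc) (smStep 3 Lc) 1) (SPerfOf … S 1) (WPerfOf … Wt 1) a b t = (same) b a (−t)` from the pins `hS1`∕`hW1`, the tables' (Wt) row `hWt`,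
their BOND-SWAP SYMMETRY `hWsymm`, and a `LocStencil` class datum of the perfect one-step stencil (`PerfectKernelSymm.TPerfOf_swap` + `PerfectJetsTranslate` +
`shiftK_KPerf_one` + `exists_decays_KPerf_holds`, all BY NAME).  With this, an2's hR row is replaced on road FP by the wall tables' symmetry. -/
theorem TPerfOf_one_swap (hLc2 : 2 ≤ Lc)
    (hS1 : ∀ j, S j 1 = (JsBal0Of hLc cE cVH cΛ W Cw' δw hδw hW' j).S) (hW1 : ∀ j, Wt j 1 = W j)
    (hWt : ∀ (j : ℕ) (μ : Fin (3 + 1)) (y : Fin (3 + 1) → ℤ) (ν : Fin (3 + 1)) (y' t : Fin (3 + 1) → ℤ),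
      W j μ (y + t) ν (y' + t) = shiftK (-((Lc : ℤ) • t)) (W j μ y ν y'))
    (hWsymm : ∀ (j : ℕ) (μ : Fin (3 + 1)) (y : Fin (3 + 1) → ℤ) (ν : Fin (3 + 1)) (y' : Fin (3 + 1) → ℤ), W j μ y ν y' = W j ν y' μ y)
    {Cs δs : ℝ} (hS : LocStencil (SPerfOf (sfStep Lc) (smStep 3 Lc) S 1) Cs δs) (hδs : 0 < δs)
    (a b : Fin (3 + 1)) (t : Fin (3 + 1) → ℤ) :
    TPerfOf Lc (KPerf (d := 3) Lc (sfStep Lc) (smStep 3 Lc) 1) (SPerfOf (sfStep Lc) (smStep 3 Lc) S 1) (WPerfOf (sfStep Lc) (smStep 3 Lc) Wt 1) a b t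
      = TPerfOf Lc (KPerf (d := 3) Lc (sfStep Lc) (smStep 3 Lc) 1) (SPerfOf (sfStep Lc) (smStep 3 Lc) S 1) (WPerfOf (sfStep Lc) (smStep 3 Lc) Wt 1)
          b a (-t) := by
  obtain ⟨CK, δK, hδK, hK⟩ := exists_decays_KPerf_holds hLc2 (m := 1) le_rfl
  have hK1 : Decays (KPerf (d := 3) Lc (sfStep Lc) (smStep 3 Lc) 1) CK δK := hK
  exact TPerfOf_swap (n := Lc) hLc hK1 hδK (shiftK_KPerf_one (d := 3) Lc (sfStep Lc) (smStep 3 Lc)) hS hδs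
    (SPerfOf_one_translate hLc cE cVH cΛ W Cw' δw hδw hW' (sfStep Lc) (smStep 3 Lc) S hS1)
    (WPerfOf_one_translate W (sfStep Lc) (smStep 3 Lc) Wt hWt hW1)
    (WPerfOf_one_symm W Wt (sfStep Lc) (smStep 3 Lc) hWsymm hW1) a b t

end Perfect

end Summit.QuantumFields.BalabanUV.Beta.FP.PerfectKernelSymmOne

end
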